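import Mathlib
import Summits.NavierStokesRegularity.NavierStokesRegularity.Theses.SubcriticalEnvelope
import HarnessLib

/-!
# `SubcriticalEnvelope.StallOfEnvelope` — uniform viscous stall from the subcritical tail envelope
and envelope smoothing (item stmt-NavierStokesRegularity-23906; pure logic)

**Statement.** `SubcriticalTailEnvelope → EnvelopeSmoothing → ∀ R ≥ 1, ViscousStall R`.

PROOF. Fix `R ≥ 1`; (A) gives a margin `η > 0`, a threshold `εs > 0` and, for every `ε₀ ≤ εs`,
every table in `E₂(R)`, every one-shell datum and every defect level `K₁ ≥ 0`, the subcritical tail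
envelope; (B) turns that envelope (at this `ε₀, η, R`, table and datum) into a global regular
viscous solution for every `ν > 0` — which is `ViscousStall R` with threshold `εs`.

HONEST FRAMING: pure logic between the route's own statements about Tao-type MODEL lattice ODEs;
both hypotheses stay hypotheses (open cruxes); nothing here bears on Navier–Stokes regularity.
-/

noncomputable section

set_option linter.dupNamespace false

namespace Summit.NavierStokesRegularity.NavierStokesRegularity.Theorems

open Summit.NavierStokesRegularity.NavierStokesRegularity.Theses.SubcriticalEnvelope in
/-- **Item stmt-NavierStokesRegularity-23906** (`SubcriticalEnvelope.StallOfEnvelope`): the subcritical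
tail envelope and envelope smoothing give uniform viscous stall `ViscousStall R` for every spread
`R ≥ 1`. Pure logic. [this file] -/
theorem subcriticalEnvelope_stallOfEnvelope_proof :
    Summit.NavierStokesRegularity.NavierStokesRegularity.Theses.SubcriticalEnvelope.StallOfEnvelope := by
  unfold Summit.NavierStokesRegularity.NavierStokesRegularity.Theses.SubcriticalEnvelope.StallOfEnvelope
    Summit.NavierStokesRegularity.NavierStokesRegularity.Theses.SubcriticalEnvelope.SubcriticalTailEnvelope
    Summit.NavierStokesRegularity.NavierStokesRegularity.Theses.SubcriticalEnvelope.EnvelopeSmoothing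
  intro hA hB R hR
  obtain ⟨η, εs, hη, hεs, hAR⟩ := hA R hR
  refine ⟨εs, hεs, fun ε₀ hε₀ hle α X₀ hα ν hν => ?_⟩
  exact hB ε₀ η R hε₀ hη α hα X₀ (fun K₁ hK₁ => hAR ε₀ hε₀ hle α hα X₀ K₁ hK₁) ν hν

end Summit.NavierStokesRegularity.NavierStokesRegularity.Theorems

end
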